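import Summits.CriticalPhenomena.SAWScalingLimit.Theorems.SAWDevelopingMapObservableToSLETypeLadderCarvedReductionSqueezeFamilyCore
import Summits.CriticalPhenomena.SAWScalingLimit.Theorems.SAWDevelopingMapObservableToSLECanonicalTransferExhaustion
import HarnessLib

/-!
# The ascent above a gate (piece (G2-fam-e) of stub T2b″ `stub_carvedReduction_squeezeSolid`)

Crux `SAWDevelopingMap.ObservableToSLE` (stmt-CriticalPhenomena-10472), line `six-class-type-ladder`,
stub T2b″.  Landing target:
`Summits/CriticalPhenomena/SAWScalingLimit/Theorems/SAWDevelopingMapObservableToSLETypeLadderCarvedReductionSqueezeFamilyAscent.lean`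
(`--supports stmt-CriticalPhenomena-10472`).  Sequel of `…SqueezeFamilyCore`.

Input of the two-piece admissible family (next file `…SqueezeFamily`): its EXACT ROWS near a gate.
A vertex `v` of row `≥ m i` within `ρF/32` of the gate `p i` is joined to the compact target disc
`B̄(p i + iρF/4, ρF/16) ⊆ Ω` by the greedy walk towards `δ c_v + iρF/4`, all of whose vertices are
within `ρF/4` of that point; this file shows that every such vertex is DEEP for the deep set of
`…SqueezeFamilyCore` (`twoPiece_ascent_deep`, registered as `stub_carvedReduction_twoPieceAscent`):
it lies in `Ω` (above the floor, in the flat disc), in no excluded zone (its row is `≥ m i`; the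
other gate is far), and its `25δ`-disc lies in `Ω` above the floor and in the exempt slab below it.
-/

noncomputable section

open scoped Topology
open Filter Set Metric
open Literature.Probability.LatticeModels (HexVertex hexGraph hexCenter Site)
open Literature.Probability.RandomPlanarGeometry
open Literature.Probability.RandomPlanarGeometry.SAW
open Literature.Probability.Percolation (PathIn hexCenter_im hexCenter_re)

namespace Summit.CriticalPhenomena.SAWScalingLimit.Theorems.ObservableToSLE.TypeLadder

open Summit.CriticalPhenomena.SAWScalingLimit.Theorems.ObservableToSLE.FloorRatio

/-! ### The ascent above a gate -/

/-- **The ascent above a gate runs through deep vertices.**  Let `u` be within `ρF/4` of the point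
`y = δ c_v + i ρF/4`, where `δ c_v` is within `ρF/32` of the gate `p i`, above its floor and of row
`≥ m i`.  If above the floor the disc `B(p i, ρF)` lies in `Ω`, the other gate is far
(`2(ρc + ρc') + ρF ≤ dist`), its excluded zone is thin (`row < m j → Im < Im(p j) + ρc'`, rows
`≥ mlo j` at height `> Im(p j) - ρc'`), `ρF ≤ ρc`, `64δ ≤ ρF`, then `u`
is deep (for the deep set with exempt slabs of depth `30δ`). -/
theorem twoPiece_ascent_deep {Ω : Set ℂ} {p : Fin 2 → ℂ} {δ ρc ρc' ρF : ℝ} {m mlo : Fin 2 → ℤ}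
    (hδ : 0 < δ) (hFc : ρF ≤ ρc) (hδF : 64 * δ ≤ ρF)
    (hsep : ∀ i j, i ≠ j → 2 * (ρc + ρc') + ρF ≤ dist (p i) (p j))
    (hfl : ∀ i, {z : ℂ | (p i).im < z.im} ∩ ball (p i) ρF ⊆ Ω)
    (hthr : ∀ j (u : HexVertex), u.1 1 < m j → ((δ : ℂ) * hexCenter u).im < (p j).im + ρc')
    (hzone : ∀ j (u : HexVertex), mlo j ≤ u.1 1 → (p j).im - ρc' < ((δ : ℂ) * hexCenter u).im)
    (i : Fin 2) {v u : HexVertex} (hvp : dist ((δ : ℂ) * hexCenter v) (p i) < ρF / 32)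
    (hvim : (p i).im < ((δ : ℂ) * hexCenter v).im) (hvm : m i ≤ v.1 1)
    (hu : dist ((δ : ℂ) * hexCenter u) ((δ : ℂ) * hexCenter v + ((ρF / 4 : ℝ) : ℂ) * Complex.I) ≤ ρF / 4) :
    (δ : ℂ) * hexCenter u ∈ Ω ∧
      (∀ j, ¬ (|((δ : ℂ) * hexCenter u).re - (p j).re| < ρc + 10 * δ ∧ mlo j ≤ u.1 1 ∧ u.1 1 < m j)) ∧
      closedBall ((δ : ℂ) * hexCenter u) (25 * δ) ⊆ Ω ∪
        ⋃ j, {x : ℂ | |x.re - (p j).re| ≤ ρc ∧ (p j).im - 30 * δ ≤ x.im ∧ x.im ≤ (p j).im} := by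
  set y : ℂ := (δ : ℂ) * hexCenter v + ((ρF / 4 : ℝ) : ℂ) * Complex.I with hy
  have hyv : dist y ((δ : ℂ) * hexCenter v) = ρF / 4 := by
    rw [hy, dist_eq_norm, add_sub_cancel_left, norm_mul, Complex.norm_real, Complex.norm_I, mul_one,
      Real.norm_of_nonneg (by linarith)]
  have hyim : y.im = ((δ : ℂ) * hexCenter v).im + ρF / 4 := by simp [hy]
  have hyre : y.re = ((δ : ℂ) * hexCenter v).re := by simp [hy]
  -- height and position of `u`
  have huim : ((δ : ℂ) * hexCenter v).im ≤ ((δ : ℂ) * hexCenter u).im := by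
    have := im_sub_im_le_dist y ((δ : ℂ) * hexCenter u)
    rw [dist_comm] at this
    linarith
  have hup : dist ((δ : ℂ) * hexCenter u) (p i) < 17 * ρF / 32 := by
    calc dist ((δ : ℂ) * hexCenter u) (p i)
        ≤ dist ((δ : ℂ) * hexCenter u) y + dist y ((δ : ℂ) * hexCenter v) + dist ((δ : ℂ) * hexCenter v) (p i) :=
          dist_triangle4 _ _ _ _
      _ < ρF / 4 + ρF / 4 + ρF / 32 := by linarith
      _ = 17 * ρF / 32 := by ring
  have huΩ : (δ : ℂ) * hexCenter u ∈ Ω :=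
    hfl i ⟨by show (p i).im < ((δ : ℂ) * hexCenter u).im; linarith, mem_ball.2 (by linarith)⟩
  have hure : |((δ : ℂ) * hexCenter u).re - (p i).re| ≤ 9 * ρF / 32 := by
    have h1 : |((δ : ℂ) * hexCenter u).re - y.re| ≤ ρF / 4 :=
      (Complex.abs_re_le_norm _).trans_eq' (by rw [Complex.sub_re]) |>.trans (by rwa [← dist_eq_norm])
    have h2 : |((δ : ℂ) * hexCenter v).re - (p i).re| ≤ ρF / 32 :=
      ((Complex.abs_re_le_norm _).trans_eq' (by rw [Complex.sub_re])).trans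
        (by rw [← dist_eq_norm]; exact hvp.le)
    rw [hyre] at h1
    obtain ⟨a1, a2⟩ := abs_le.1 h1
    obtain ⟨b1, b2⟩ := abs_le.1 h2
    rw [abs_le]; constructor <;> linarith
  refine ⟨huΩ, fun j ⟨hj1, hj2, hj3⟩ => ?_, fun x hx => ?_⟩
  · -- no zone
    by_cases hji : j = i
    · subst hji
      exact ((hvm.trans (row_le_of_im_le hδ huim)).not_gt hj3)
    · have h1 := hthr j u hj3
      have h2 := hzone j u hj2
      have h3 : dist ((δ : ℂ) * hexCenter u) (p j) < ρc + 10 * δ + ρc' := by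
        have := dist_le_abs_re_add_abs_im ((δ : ℂ) * hexCenter u) (p j)
        rw [Complex.sub_re, Complex.sub_im] at this
        have h4 : |((δ : ℂ) * hexCenter u).im - (p j).im| < ρc' := by
          rw [abs_lt]; constructor <;> linarith
        linarith
      have h5 := hsep i j (Ne.symm hji)
      have h6 : dist (p i) (p j) ≤ dist ((δ : ℂ) * hexCenter u) (p i) + dist ((δ : ℂ) * hexCenter u) (p j) :=
        dist_triangle_left _ _ _
      linarith
  · -- the disc
    rw [mem_closedBall] at hx
    by_cases hxim : (p i).im < x.im
    · refine Or.inl (hfl i ⟨hxim, mem_ball.2 ?_⟩)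
      calc dist x (p i) ≤ dist x ((δ : ℂ) * hexCenter u) + dist ((δ : ℂ) * hexCenter u) (p i) :=
            dist_triangle _ _ _
        _ < 25 * δ + 17 * ρF / 32 := by linarith
        _ ≤ ρF := by linarith
    · push Not at hxim
      refine Or.inr (mem_iUnion.2 ⟨i, ?_, ?_, hxim⟩)
      · have h1 : |x.re - ((δ : ℂ) * hexCenter u).re| ≤ 25 * δ :=
          ((Complex.abs_re_le_norm _).trans_eq' (by rw [Complex.sub_re])).trans (by rwa [← dist_eq_norm])
        obtain ⟨a1, a2⟩ := abs_le.1 h1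
        obtain ⟨b1, b2⟩ := abs_le.1 hure
        rw [abs_le]; constructor <;> linarith
      · have h1 := im_sub_im_le_dist ((δ : ℂ) * hexCenter u) x
        rw [dist_comm] at h1
        linarith

/-- **Registered sub-goal `stub_carvedReduction_twoPieceAscent`** (crux item
stmt-CriticalPhenomena-10472, stub T2b″ `stub_carvedReduction_squeezeSolid`, piece (G2-fam-e) THE ASCENT
ABOVE A GATE IS DEEP): registry form of `twoPiece_ascent_deep`. -/
theorem stub_carvedReduction_twoPieceAscent :
    ∀ (Ω : Set ℂ) (p : Fin 2 → ℂ) (δ ρc ρc' ρF : ℝ) (m mlo : Fin 2 → ℤ) (i : Fin 2) (v u : HexVertex),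
      0 < δ → ρF ≤ ρc → 64 * δ ≤ ρF →
      (∀ i j, i ≠ j → 2 * (ρc + ρc') + ρF ≤ dist (p i) (p j)) →
      (∀ i, {z : ℂ | (p i).im < z.im} ∩ ball (p i) ρF ⊆ Ω) →
      (∀ j (u : HexVertex), u.1 1 < m j → ((δ : ℂ) * hexCenter u).im < (p j).im + ρc') →
      (∀ j (u : HexVertex), mlo j ≤ u.1 1 → (p j).im - ρc' < ((δ : ℂ) * hexCenter u).im) →
      dist ((δ : ℂ) * hexCenter v) (p i) < ρF / 32 → (p i).im < ((δ : ℂ) * hexCenter v).im → m i ≤ v.1 1 →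
      dist ((δ : ℂ) * hexCenter u) ((δ : ℂ) * hexCenter v + ((ρF / 4 : ℝ) : ℂ) * Complex.I) ≤ ρF / 4 →
      (δ : ℂ) * hexCenter u ∈ Ω ∧
        (∀ j, ¬ (|((δ : ℂ) * hexCenter u).re - (p j).re| < ρc + 10 * δ ∧ mlo j ≤ u.1 1 ∧ u.1 1 < m j)) ∧
        closedBall ((δ : ℂ) * hexCenter u) (25 * δ) ⊆ Ω ∪
          ⋃ j, {x : ℂ | |x.re - (p j).re| ≤ ρc ∧ (p j).im - 30 * δ ≤ x.im ∧ x.im ≤ (p j).im} :=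
  fun _ _ _ _ _ _ _ _ i _ _ hδ hFc hδF hsep hfl hthr hzone hvp hvim hvm hu =>
    twoPiece_ascent_deep hδ hFc hδF hsep hfl hthr hzone i hvp hvim hvm hu

end Summit.CriticalPhenomena.SAWScalingLimit.Theorems.ObservableToSLE.TypeLadder

end
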